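import Mathlib
import Literature.MathematicalPhysics.StatisticalMechanics.OneCrossingMixture

/-!
# Crux `ExactCertificate` (stmt-AtomisticToContinuum-11959), line `closure-makes-nogap-exact`,
# Transfer1D skeleton — stub `stub_coreOf`: the core inequality `g ≥ 0` of the d = 1 exact certificate

Support file (`--supports stmt-AtomisticToContinuum-11959`); nothing here closes the 3-D crux.

The d = 1 exact Lennard-Jones certificate (`…Cruxes.ExactCertificate.Transfer1D.ExactCertificate1D`) uses the
tail interpolant `F_a(x) = Σ_{k≥0} (k+1)[V(|x+a|+(k+1)a) − 2V(|x|+(k+1)a) + V(|x−a|+(k+1)a)]`, `V = lennardJones`,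
at the zero-pressure lattice constant `a`.  This file proves the CORE INEQUALITY `F_a(r) ≤ V(r)` for `0 < r < a`
(so the finite-range remainder `g = (V − F_a)1_{(0,a)}` is non-negative, hence `0`-stable), from the registered
single-crossing statement (`stub_crossing`, taken here as a hypothesis — the skeleton supplies it):

* reindexing (`lennardJones_sub_F_eq`): with `u = a − r`,
  `V(r) − F_a(r) = Σ_{k≥0} (k+1)·[V((k+1)a − u) − V((k+1)a + u)]`;
* Laplace (`lennardJones_eq_neg_integral`): `V(c) = −∫₀^∞ e^{−tc} p(t) dt`, `p(t) = t⁵/720 − t¹¹/479001600`, so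
  `V((k+1)a − u) − V((k+1)a + u) = 2∫₀^∞ e^{−t(k+1)a} p(t)·t·h(t) dt` with `h(t) = −sinh(tu)/t`;
* `h` is antitone on `(0,∞)` (`antitoneOn_neg_sinh_div`: `x ↦ sinh x / x` is monotone, by convexity of `sinh` on `[0,∞)`);
* the crossing statement then gives `Σ_k (k+1)∫ e^{−t(k+1)a} p t h ≥ 0`, i.e. `V(r) − F_a(r) ≥ 0`.
-/

noncomputable section

namespace Summit.AtomisticToContinuum.Crystallization.Theorems.ThreeConeCertificateExactCertificate.Transfer1D

open Literature.MathematicalPhysics.StatisticalMechanics MeasureTheory Set Real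
open scoped BigOperators Nat

/-! ## Decay of `V` and summability of the weighted chain sums -/

/-- `|V(r)| ≤ c⁻¹²/12 + c⁻⁶/6` for `0 < c ≤ r` (both inverse powers are antitone). [folklore] -/
theorem abs_lennardJones_le_of_le {c r : ℝ} (hc : 0 < c) (hcr : c ≤ r) :
    |lennardJones r| ≤ (1 / 12) * (c⁻¹) ^ 12 + (1 / 6) * (c⁻¹) ^ 6 := by
  have hr : 0 < r := hc.trans_le hcr
  have hinv : r⁻¹ ≤ c⁻¹ := by
    rw [inv_le_inv₀ hr hc]; exact hcr
  have h0 : 0 ≤ r⁻¹ := inv_nonneg.2 hr.le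
  have h12 : (r⁻¹) ^ 12 ≤ (c⁻¹) ^ 12 := pow_le_pow_left₀ h0 hinv 12
  have h6 : (r⁻¹) ^ 6 ≤ (c⁻¹) ^ 6 := pow_le_pow_left₀ h0 hinv 6
  unfold lennardJones
  rw [abs_le]
  constructor <;> nlinarith [pow_nonneg h0 12, pow_nonneg h0 6]

/-- Summability of `k ↦ (k+1)·V(g k)` whenever `g k ≥ (k+1)c` for some `c > 0`:
`|(k+1)V(g k)| ≤ (c⁻¹²/12 + c⁻⁶/6)·(k+1)⁻⁵`. [folklore] -/
theorem summable_mul_lennardJones_of_le {c : ℝ} (hc : 0 < c) (g : ℕ → ℝ)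
    (hg : ∀ k : ℕ, ((k : ℝ) + 1) * c ≤ g k) :
    Summable (fun k : ℕ => ((k : ℝ) + 1) * lennardJones (g k)) := by
  set C : ℝ := (1 / 12) * (c⁻¹) ^ 12 + (1 / 6) * (c⁻¹) ^ 6 with hC
  have hC0 : 0 ≤ C := by positivity
  -- the comparison series `C·(k+1)⁻⁵`
  have hs5 : Summable (fun k : ℕ => C * ((k : ℝ) + 1)⁻¹ ^ 5) := by
    have h := (Real.summable_nat_pow_inv.2 (by norm_num : 1 < 5))
    have h' := ((summable_nat_add_iff 1).2 h).mul_left C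
    refine h'.congr fun k => ?_
    push_cast
    rw [inv_pow]
  refine Summable.of_norm_bounded hs5 fun k => ?_
  have hk : (0 : ℝ) < (k : ℝ) + 1 := by positivity
  have hkc : 0 < ((k : ℝ) + 1) * c := mul_pos hk hc
  have hV := abs_lennardJones_le_of_le hkc (hg k)
  -- `((k+1)c)⁻ⁿ = (k+1)⁻ⁿ c⁻ⁿ` and `(k+1)⁻¹² ≤ (k+1)⁻⁶`
  have hk1 : ((k : ℝ) + 1)⁻¹ ≤ 1 := by
    rw [inv_le_one₀ hk]; linarith [(k.cast_nonneg : (0 : ℝ) ≤ k)]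
  have hk0 : 0 ≤ ((k : ℝ) + 1)⁻¹ := inv_nonneg.2 hk.le
  have hpow : ((k : ℝ) + 1)⁻¹ ^ 12 ≤ ((k : ℝ) + 1)⁻¹ ^ 6 :=
    pow_le_pow_of_le_one hk0 hk1 (by norm_num)
  have hV' : |lennardJones (g k)| ≤ C * ((k : ℝ) + 1)⁻¹ ^ 6 := by
    calc |lennardJones (g k)| ≤ (1 / 12) * ((((k : ℝ) + 1) * c)⁻¹) ^ 12
          + (1 / 6) * ((((k : ℝ) + 1) * c)⁻¹) ^ 6 := hV
      _ = (1 / 12) * (c⁻¹) ^ 12 * ((k : ℝ) + 1)⁻¹ ^ 12 + (1 / 6) * (c⁻¹) ^ 6 * ((k : ℝ) + 1)⁻¹ ^ 6 := by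
          rw [mul_inv, mul_pow, mul_pow]; ring
      _ ≤ (1 / 12) * (c⁻¹) ^ 12 * ((k : ℝ) + 1)⁻¹ ^ 6 + (1 / 6) * (c⁻¹) ^ 6 * ((k : ℝ) + 1)⁻¹ ^ 6 := by
          gcongr
      _ = C * ((k : ℝ) + 1)⁻¹ ^ 6 := by rw [hC]; ring
  rw [Real.norm_eq_abs, abs_mul, abs_of_pos hk]
  calc ((k : ℝ) + 1) * |lennardJones (g k)| ≤ ((k : ℝ) + 1) * (C * ((k : ℝ) + 1)⁻¹ ^ 6) :=
        mul_le_mul_of_nonneg_left hV' hk.le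
    _ = C * ((k : ℝ) + 1)⁻¹ ^ 5 := by
        field_simp

/-! ## Laplace representation of `V` -/

/-- `t ↦ e^{−tc} p(t)` is integrable on `(0,∞)` for `c > 0`, `p(t) = t⁵/720 − t¹¹/479001600`. [folklore] -/
theorem integrableOn_exp_mul_p {c : ℝ} (hc : 0 < c) :
    IntegrableOn (fun t : ℝ => Real.exp (-(t * c)) * (t ^ 5 / 720 - t ^ 11 / 479001600)) (Ioi 0) := by
  have h5 := (integrableOn_exp_neg_mul_mul_pow 5 hc).div_const 720
  have h11 := (integrableOn_exp_neg_mul_mul_pow 11 hc).div_const 479001600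
  refine IntegrableOn.congr_fun (h5.sub h11) (fun t _ => ?_) measurableSet_Ioi
  simp only [Pi.sub_apply]
  ring

/-- LAPLACE REPRESENTATION: `V(c) = −∫₀^∞ e^{−tc} (t⁵/720 − t¹¹/479001600) dt` for `c > 0`
(`∫₀^∞ e^{−tc}t⁵ = 5!/c⁶`, `∫₀^∞ e^{−tc}t¹¹ = 11!/c¹²`). [folklore] -/
theorem lennardJones_eq_neg_integral {c : ℝ} (hc : 0 < c) :
    lennardJones c = -∫ t in Ioi (0 : ℝ), Real.exp (-(t * c)) * (t ^ 5 / 720 - t ^ 11 / 479001600) := by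
  have h5 := integral_exp_neg_mul_mul_pow 5 hc
  have h11 := integral_exp_neg_mul_mul_pow 11 hc
  have i5 := integrableOn_exp_neg_mul_mul_pow 5 hc
  have i11 := integrableOn_exp_neg_mul_mul_pow 11 hc
  have hsplit : (fun t : ℝ => Real.exp (-(t * c)) * (t ^ 5 / 720 - t ^ 11 / 479001600)) =
      fun t => (Real.exp (-(t * c)) * t ^ 5) / 720 - (Real.exp (-(t * c)) * t ^ 11) / 479001600 := by
    funext t; ring
  rw [hsplit, integral_sub (i5.div_const _) (i11.div_const _), integral_div, integral_div, h5, h11]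
  simp only [Nat.factorial, Nat.succ_eq_add_one, Nat.cast_ofNat, Nat.reduceAdd, Nat.reduceMul]
  unfold lennardJones
  have hc0 : c ≠ 0 := hc.ne'
  field_simp
  ring

/-! ## `x ↦ sinh x / x` is monotone on `(0,∞)` -/

/-- `sinh` is convex on `[0, ∞)` (`sinh'' = sinh ≥ 0` there). [folklore] -/
theorem convexOn_sinh_Ici : ConvexOn ℝ (Ici (0 : ℝ)) Real.sinh := by
  refine convexOn_of_deriv2_nonneg (convex_Ici 0) Real.continuous_sinh.continuousOn
    (Real.differentiable_sinh.differentiableOn) ?_ ?_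
  · rw [Real.deriv_sinh]
    exact Real.differentiable_cosh.differentiableOn
  · intro x hx
    rw [interior_Ici] at hx
    have : deriv^[2] Real.sinh = Real.sinh := by
      simp [Real.deriv_sinh, Real.deriv_cosh]
    rw [this]
    exact Real.sinh_nonneg_iff.2 (le_of_lt hx)

/-- For `u ≥ 0`, `t ↦ −sinh(tu)/t` is antitone on `(0,∞)` (secant slopes of the convex function `sinh` from `0`
are monotone). [folklore] -/
theorem antitoneOn_neg_sinh_div {u : ℝ} (hu : 0 ≤ u) :
    AntitoneOn (fun t : ℝ => -(Real.sinh (t * u) / t)) (Ioi 0) := by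
  intro s hs t ht hst
  simp only [neg_le_neg_iff]
  rcases hu.eq_or_lt with rfl | hu'
  · simp
  -- slopes of `sinh` from `0` at `su ≤ tu`
  have hs' : (0 : ℝ) < s := hs
  have ht' : (0 : ℝ) < t := ht
  have hsu : 0 < s * u := mul_pos hs' hu'
  have htu : 0 < t * u := mul_pos ht' hu'
  have key := convexOn_sinh_Ici.secant_mono (a := 0) (x := s * u) (y := t * u)
    (self_mem_Ici) (le_of_lt hsu) (le_of_lt htu) hsu.ne' htu.ne'
    (mul_le_mul_of_nonneg_right hst hu)
  simp only [Real.sinh_zero, sub_zero] at key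
  -- `sinh(su)/(su) ≤ sinh(tu)/(tu)` ⇒ `sinh(su)/s ≤ sinh(tu)/t`
  have h1 : Real.sinh (s * u) / s = u * (Real.sinh (s * u) / (s * u)) := by
    field_simp
  have h2 : Real.sinh (t * u) / t = u * (Real.sinh (t * u) / (t * u)) := by
    field_simp
  rw [h1, h2]
  exact mul_le_mul_of_nonneg_left key hu

/-! ## Series algebra: the second difference with retarded weights, reindexed -/

/-- Reindexing identity (pure series algebra): if `Σ(k+1)A_k`, `ΣA_k`, `Σ(k+1)B_k` converge, then
`Σ_{k≥0} (k+1)·(A_{k+2} − 2A_{k+1} + B_k) = A_0 − (Σ(k+1)A_k − Σ(k+1)B_k)`. [folklore] -/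
theorem hasSum_second_difference {A B : ℕ → ℝ} {SA1 SA0 SB1 : ℝ}
    (hA : HasSum (fun k : ℕ => ((k : ℝ) + 1) * A k) SA1) (hA0 : HasSum A SA0)
    (hB : HasSum (fun k : ℕ => ((k : ℝ) + 1) * B k) SB1) :
    HasSum (fun k : ℕ => ((k : ℝ) + 1) * (A (k + 2) - 2 * A (k + 1) + B k)) (A 0 - (SA1 - SB1)) := by
  -- shifts by one and by two of the two `A`-series
  have hA_1 := (hasSum_nat_add_iff' 1).2 hA
  have hA0_1 := (hasSum_nat_add_iff' 1).2 hA0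
  have hA_2 := (hasSum_nat_add_iff' 2).2 hA
  have hA0_2 := (hasSum_nat_add_iff' 2).2 hA0
  simp only [Finset.sum_range_succ, Finset.sum_range_zero, zero_add, Nat.cast_zero, Nat.cast_one,
    Nat.cast_add, Nat.cast_ofNat] at hA_1 hA0_1 hA_2 hA0_2
  -- combine: `(k+1)A_{k+2} = (k+3)A_{k+2} − 2A_{k+2}`, `(k+1)A_{k+1} = (k+2)A_{k+1} − A_{k+1}`
  have h := ((hA_2.sub (hA0_2.mul_left 2)).sub ((hA_1.sub hA0_1).mul_left 2)).add hB
  have hv : A 0 - (SA1 - SB1) =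
      SA1 - (1 * A 0 + (1 + 1) * A 1) - 2 * (SA0 - (A 0 + A 1)) - 2 * (SA1 - 1 * A 0 - (SA0 - A 0)) + SB1 := by
    ring
  rw [hv]
  exact h.congr_fun fun k => by ring

/-! ## The core inequality -/

/-- The crossing integrand for `h(t) = −sinh(tu)/t`: for `t > 0`,
`e^{−tb} p(t)·(t·h(t)) = −½·(e^{−t(b−u)} p(t) − e^{−t(b+u)} p(t))`. [folklore] -/
theorem crossing_integrand_sinh (b u : ℝ) {t : ℝ} (ht : 0 < t) :
    Real.exp (-(t * b)) * (t ^ 5 / 720 - t ^ 11 / 479001600) * (t * (-(Real.sinh (t * u) / t)))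
      = -(1 / 2) * (Real.exp (-(t * (b - u))) * (t ^ 5 / 720 - t ^ 11 / 479001600)
          - Real.exp (-(t * (b + u))) * (t ^ 5 / 720 - t ^ 11 / 479001600)) := by
  have ht0 : t ≠ 0 := ht.ne'
  have e1 : Real.exp (-(t * (b - u))) = Real.exp (-(t * b)) * Real.exp (t * u) := by
    rw [← Real.exp_add]; congr 1; ring
  have e2 : Real.exp (-(t * (b + u))) = Real.exp (-(t * b)) * Real.exp (-(t * u)) := by
    rw [← Real.exp_add]; congr 1; ring
  have e3 : t * (-(Real.sinh (t * u) / t)) = -Real.sinh (t * u) := by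
    field_simp
  rw [e1, e2, e3, Real.sinh_eq]
  ring

/-- **STUB `stub_coreOf`** (registered on stmt-AtomisticToContinuum-11959, Transfer1D skeleton): from the
single-crossing statement (hypothesis; = stub `stub_crossing`), for every zero-pressure `a > 0` the tail
interpolant `F_a` lies below `V` on `(0,a)` — i.e. the finite-range remainder `g = V − F_a ≥ 0` there.
Proof: `V(r) − F_a(r) = Σ_k (k+1)[V((k+1)a−u) − V((k+1)a+u)] = 2Σ_k (k+1)∫₀^∞ e^{−t(k+1)a}p(t)·t·h(t)dt ≥ 0`
with `u = a − r` and the antitone `h(t) = −sinh(tu)/t`. [folklore] -/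
theorem stub_coreOf :
    (∀ a : ℝ, 0 < a →
      HasSum (fun k : ℕ => ((k : ℝ) + 1) * ((((k : ℝ) + 1) * a)⁻¹ ^ 7 - (((k : ℝ) + 1) * a)⁻¹ ^ 13)) 0 →
      ∀ h : ℝ → ℝ, AntitoneOn h (Set.Ioi 0) →
      (∀ k : ℕ, MeasureTheory.IntegrableOn (fun t : ℝ => Real.exp (-(t * (((k : ℝ) + 1) * a)))
        * (t ^ 5 / 720 - t ^ 11 / 479001600) * (t * h t)) (Set.Ioi 0)) →
      Summable (fun k : ℕ => ((k : ℝ) + 1) * ∫ t in Set.Ioi (0 : ℝ), Real.exp (-(t * (((k : ℝ) + 1) * a)))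
        * (t ^ 5 / 720 - t ^ 11 / 479001600) * (t * h t)) →
      0 ≤ ∑' k : ℕ, ((k : ℝ) + 1) * ∫ t in Set.Ioi (0 : ℝ), Real.exp (-(t * (((k : ℝ) + 1) * a)))
        * (t ^ 5 / 720 - t ^ 11 / 479001600) * (t * h t)) →
    ∀ a : ℝ, 0 < a →
    HasSum (fun k : ℕ => ((k : ℝ) + 1) * ((((k : ℝ) + 1) * a)⁻¹ ^ 7 - (((k : ℝ) + 1) * a)⁻¹ ^ 13)) 0 →
    ∀ r : ℝ, 0 < r → r < a →
      ∑' k : ℕ, ((k : ℝ) + 1) * (lennardJones (|r + a| + ((k : ℝ) + 1) * a)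
        - 2 * lennardJones (|r| + ((k : ℝ) + 1) * a) + lennardJones (|r - a| + ((k : ℝ) + 1) * a)) ≤ lennardJones r := by
  intro hCR a ha hz r hr hra
  -- `u = a − r ∈ (0, a)`
  set u : ℝ := a - r with hu
  have hu0 : 0 < u := sub_pos.2 hra
  -- the two chain families `A_k = V((k+1)a − u)`, `B_k = V((k+1)a + u)`
  set A : ℕ → ℝ := fun k => lennardJones (((k : ℝ) + 1) * a - u) with hAdef
  set B : ℕ → ℝ := fun k => lennardJones (((k : ℝ) + 1) * a + u) with hBdef
  -- summability (decay of `V`: the arguments are `≥ (k+1)r`, resp. `≥ (k+1)a`)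
  have hgA : ∀ k : ℕ, ((k : ℝ) + 1) * r ≤ ((k : ℝ) + 1) * a - u := by
    intro k
    rw [hu]
    nlinarith [(k.cast_nonneg : (0 : ℝ) ≤ k), hra.le]
  have hgB : ∀ k : ℕ, ((k : ℝ) + 1) * a ≤ ((k : ℝ) + 1) * a + u := fun k => by linarith
  have hsA : Summable (fun k : ℕ => ((k : ℝ) + 1) * A k) := summable_mul_lennardJones_of_le hr _ hgA
  have hsB : Summable (fun k : ℕ => ((k : ℝ) + 1) * B k) := summable_mul_lennardJones_of_le ha _ hgB
  have hsA0 : Summable A := by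
    refine Summable.of_norm_bounded hsA.norm fun k => ?_
    rw [Real.norm_eq_abs, Real.norm_eq_abs, abs_mul, abs_of_pos (by positivity : (0 : ℝ) < (k : ℝ) + 1)]
    exact le_mul_of_one_le_left (abs_nonneg _) (by linarith [(k.cast_nonneg : (0 : ℝ) ≤ k)])
  -- positivity of the arguments
  have hbu : ∀ k : ℕ, 0 < ((k : ℝ) + 1) * a - u := fun k =>
    lt_of_lt_of_le (by positivity : (0 : ℝ) < ((k : ℝ) + 1) * r) (hgA k)
  have hbu' : ∀ k : ℕ, 0 < ((k : ℝ) + 1) * a + u := fun k => by positivity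
  -- STEP 1: reindexing `F_a(r) = V(r) − (Σ(k+1)A_k − Σ(k+1)B_k)`
  have hF : HasSum (fun k : ℕ => ((k : ℝ) + 1) * (lennardJones (|r + a| + ((k : ℝ) + 1) * a)
      - 2 * lennardJones (|r| + ((k : ℝ) + 1) * a) + lennardJones (|r - a| + ((k : ℝ) + 1) * a)))
      (lennardJones r - (∑' k : ℕ, ((k : ℝ) + 1) * A k - ∑' k : ℕ, ((k : ℝ) + 1) * B k)) := by
    have h := hasSum_second_difference hsA.hasSum hsA0.hasSum hsB.hasSum
    have hA0r : A 0 = lennardJones r := by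
      simp only [hAdef, Nat.cast_zero, zero_add, one_mul, hu, sub_sub_cancel]
    rw [hA0r] at h
    refine h.congr_fun fun k => ?_
    have e1 : |r + a| + ((k : ℝ) + 1) * a = (((k + 2 : ℕ) : ℝ) + 1) * a - u := by
      rw [abs_of_pos (by linarith), hu]; push_cast; ring
    have e2 : |r| + ((k : ℝ) + 1) * a = (((k + 1 : ℕ) : ℝ) + 1) * a - u := by
      rw [abs_of_pos hr, hu]; push_cast; ring
    have e3 : |r - a| + ((k : ℝ) + 1) * a = ((k : ℝ) + 1) * a + u := by
      rw [abs_of_neg (by linarith), hu]; ring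
    rw [e1, e2, e3]
  rw [hF.tsum_eq]
  -- STEP 2: it remains `0 ≤ Σ(k+1)A_k − Σ(k+1)B_k`, from the crossing statement with `h(t) = −sinh(tu)/t`
  suffices hpos : 0 ≤ ∑' k : ℕ, ((k : ℝ) + 1) * A k - ∑' k : ℕ, ((k : ℝ) + 1) * B k by linarith
  set h : ℝ → ℝ := fun t => -(Real.sinh (t * u) / t) with hhdef
  -- Laplace: the crossing integral of index `k` equals `(A_k − B_k)/2`
  have hcongr : ∀ k : ℕ, EqOn
      (fun t : ℝ => Real.exp (-(t * (((k : ℝ) + 1) * a))) * (t ^ 5 / 720 - t ^ 11 / 479001600) * (t * h t))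
      (fun t : ℝ => -(1 / 2) * (Real.exp (-(t * (((k : ℝ) + 1) * a - u))) * (t ^ 5 / 720 - t ^ 11 / 479001600)
        - Real.exp (-(t * (((k : ℝ) + 1) * a + u))) * (t ^ 5 / 720 - t ^ 11 / 479001600))) (Ioi 0) :=
    fun k t ht => crossing_integrand_sinh _ _ ht
  have hint : ∀ k : ℕ, ∫ t in Ioi (0 : ℝ), Real.exp (-(t * (((k : ℝ) + 1) * a)))
      * (t ^ 5 / 720 - t ^ 11 / 479001600) * (t * h t) = (1 / 2) * (A k - B k) := by
    intro k
    rw [setIntegral_congr_fun measurableSet_Ioi (hcongr k), integral_const_mul,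
      integral_sub (integrableOn_exp_mul_p (hbu k)) (integrableOn_exp_mul_p (hbu' k))]
    simp only [hAdef, hBdef]
    rw [lennardJones_eq_neg_integral (hbu k), lennardJones_eq_neg_integral (hbu' k)]
    ring
  -- the three hypotheses of the crossing statement
  have hanti : AntitoneOn h (Ioi 0) := antitoneOn_neg_sinh_div hu0.le
  have hInt : ∀ k : ℕ, IntegrableOn (fun t : ℝ => Real.exp (-(t * (((k : ℝ) + 1) * a)))
      * (t ^ 5 / 720 - t ^ 11 / 479001600) * (t * h t)) (Ioi 0) := by
    intro k
    refine IntegrableOn.congr_fun ?_ (hcongr k).symm measurableSet_Ioi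
    exact ((integrableOn_exp_mul_p (hbu k)).sub (integrableOn_exp_mul_p (hbu' k))).const_mul _
  have hfun : (fun k : ℕ => ((k : ℝ) + 1) * ∫ t in Ioi (0 : ℝ), Real.exp (-(t * (((k : ℝ) + 1) * a)))
      * (t ^ 5 / 720 - t ^ 11 / 479001600) * (t * h t))
      = fun k : ℕ => (1 / 2) * (((k : ℝ) + 1) * A k - ((k : ℝ) + 1) * B k) := by
    funext k
    rw [hint k]
    ring
  have hSum : Summable (fun k : ℕ => ((k : ℝ) + 1) * ∫ t in Ioi (0 : ℝ), Real.exp (-(t * (((k : ℝ) + 1) * a)))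
      * (t ^ 5 / 720 - t ^ 11 / 479001600) * (t * h t)) := by
    rw [hfun]
    exact (hsA.sub hsB).mul_left _
  have key := hCR a ha hz h hanti hInt hSum
  rw [hfun, tsum_mul_left, hsA.tsum_sub hsB] at key
  linarith

end Summit.AtomisticToContinuum.Crystallization.Theorems.ThreeConeCertificateExactCertificate.Transfer1D

end
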